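import Mathlib
import HarnessLib.Audit
import Summits.PneNP.PneNP.Theorems.PstarUnionAtoms

/-!
# No free bridge: the flip lemma (ROUND-24, memo §14.17; ASK T-UNION-TRI (2), A5)

FRONTIER range-avoidance ladder, rung F-N3, ROUND 24 (cell `pnp-ideate`, planner memo `r24/CORE-BOUND-NOTES.md` §14.17, typed sketch `r24/SketchAtoms.lean` (update 19:00Z)
of planner p3 g22, statement A5 VERBATIM; restricted-model proof complexity — nothing here bears on `P` versus `NP`).

* `flipOn S x` — flip every variable of `S`;
* `eval_flipOn` — an output meeting `S` in an even (odd) number of XOR slots and in no AND slot keeps (flips) its value;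
* `gval_flipOn` — a G-constraint whose linear part meets `S` evenly and whose monomials avoid `S` keeps its value;
* `satPair_of_erase_bridge` — **A5, NO FREE BRIDGE**: `S` one side of the F-edge `e` (met oddly by `e`, evenly by every other output of `J₀`, never in an AND slot,
  read evenly by `A` and `w₂`) ⟹ `SatPair (J₀ − e) A w₂ → SatPair J₀ A w₂` (flip the witness along `S`).
-/

set_option linter.dupNamespace false -- `Summit.PneNP.PneNP.…`: summit = sub-problem name (D-0017 single-conjunct layout)

open Finset Literature.Computability.Complexity
open Summit.PneNP.PneNP.Theorems.PstarFibrePolys (bit bit_injective)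
open Summit.PneNP.PneNP.Theorems.PstarGapOneAll (gval)
open Summit.PneNP.PneNP.Theorems.PstarGConstraint (bit_gval)
open Summit.PneNP.PneNP.Theorems.PstarUnion (SatPair)

namespace Summit.PneNP.PneNP.Theorems.PstarUnionBridge

variable {n m : ℕ}

/-- flip every variable of `S` -/
def flipOn (S : Finset (Fin n)) (x : Fin n → Bool) : Fin n → Bool := fun v => if v ∈ S then !x v else x v

/-- Bits after the flip. -/
theorem bit_flipOn (S : Finset (Fin n)) (x : Fin n → Bool) (v : Fin n) : bit (flipOn S x v) = bit (x v) + if v ∈ S then 1 else 0 := by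
  unfold flipOn
  by_cases h : v ∈ S
  · rw [if_pos h, if_pos h]; cases x v <;> decide
  · rw [if_neg h, if_neg h, add_zero]

/-- The XOR-slot count of `S` in an output, as indicators. -/
theorem card_xslots (I : LocalMap 4 n m) (j : Fin m) (S : Finset (Fin n)) :
    (univ.filter fun s : Fin 4 => s.val < 2 ∧ I.vars j s ∈ S).card = (if I.vars j 0 ∈ S then 1 else 0) + (if I.vars j 1 ∈ S then 1 else 0) := by
  rw [card_filter, Fin.sum_univ_four]
  simp

/-- **An output meeting `S` in no AND slot changes by the parity of its XOR slots in `S`.** -/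
theorem bit_eval_flipOn (I : LocalMap 4 n m) (hI : I.IsPure xorAndPred) (S : Finset (Fin n)) (x : Fin n → Bool) (j : Fin m)
    (hand : I.vars j 2 ∉ S ∧ I.vars j 3 ∉ S) :
    bit (I.eval (flipOn S x) j) = bit (I.eval x j) + ((univ.filter fun s : Fin 4 => s.val < 2 ∧ I.vars j s ∈ S).card : ℕ) := by
  rw [PstarPDT.bit_eval hI, PstarPDT.bit_eval hI, bit_flipOn, bit_flipOn, bit_flipOn, bit_flipOn, if_neg hand.1, if_neg hand.2, card_xslots]
  push_cast
  split_ifs <;> simp <;> ring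

/-- Even parity: the output keeps its value. -/
theorem eval_flipOn_of_even (I : LocalMap 4 n m) (hI : I.IsPure xorAndPred) (S : Finset (Fin n)) (x : Fin n → Bool) (j : Fin m)
    (hand : I.vars j 2 ∉ S ∧ I.vars j 3 ∉ S) (heven : Even ((univ.filter fun s : Fin 4 => s.val < 2 ∧ I.vars j s ∈ S).card)) :
    I.eval (flipOn S x) j = I.eval x j := by
  apply bit_injective
  rw [bit_eval_flipOn I hI S x j hand, (ZMod.natCast_eq_zero_iff_even).2 heven, add_zero]

/-- Odd parity: the output flips. -/
theorem eval_flipOn_of_odd (I : LocalMap 4 n m) (hI : I.IsPure xorAndPred) (S : Finset (Fin n)) (x : Fin n → Bool) (j : Fin m)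
    (hand : I.vars j 2 ∉ S ∧ I.vars j 3 ∉ S) (hodd : Odd ((univ.filter fun s : Fin 4 => s.val < 2 ∧ I.vars j s ∈ S).card)) :
    I.eval (flipOn S x) j = !I.eval x j := by
  apply bit_injective
  rw [bit_eval_flipOn I hI S x j hand, (ZMod.natCast_eq_one_iff_odd).2 hodd]
  cases I.eval x j <;> decide

/-- **A G-constraint read evenly by `S` (and with monomials off `S`) keeps its value.** -/
theorem gval_flipOn (I : LocalMap 4 n m) (S : Finset (Fin n)) (x : Fin n → Bool) (A : Finset (Fin n) × Finset (Fin m) × Bool)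
    (hand : ∀ g ∈ A.2.1, I.vars g 2 ∉ S ∧ I.vars g 3 ∉ S) (heven : Even ((A.1 ∩ S).card)) :
    gval I A.1 A.2.1 (flipOn S x) = gval I A.1 A.2.1 x := by
  classical
  apply bit_injective
  rw [bit_gval, bit_gval]
  have hmono : ∑ g ∈ A.2.1, bit (flipOn S x (I.vars g 2)) * bit (flipOn S x (I.vars g 3)) = ∑ g ∈ A.2.1, bit (x (I.vars g 2)) * bit (x (I.vars g 3)) :=
    sum_congr rfl fun g hg => by
      unfold flipOn; rw [if_neg (hand g hg).1, if_neg (hand g hg).2]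
  have hlin : ∑ v ∈ A.1, bit (flipOn S x v) = ∑ v ∈ A.1, bit (x v) + ((A.1 ∩ S).card : ℕ) := by
    rw [sum_congr rfl fun v _ => bit_flipOn S x v, sum_add_distrib, ← sum_filter, sum_const, filter_mem_eq_inter, nsmul_eq_mul, mul_one]
  rw [hmono, hlin, (ZMod.natCast_eq_zero_iff_even).2 heven, add_zero]

/-- **A5 — NO FREE BRIDGE (the flip lemma, memo §14.17).**  `S` is one side of the F-edge `e` (a set of XOR variables met an odd number of
times by `e`, an even number of times by every other output of `J₀`, never in an AND slot, and read evenly by the linear parts of `A` and `w₂`).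
Then a solution of `J₀ − e` with `A ∧ w₂` flips along `S` into a solution of `J₀` with `A ∧ w₂`; so such an `e` is never necessary. -/
theorem satPair_of_erase_bridge (I : LocalMap 4 n m) (hI : I.IsPure xorAndPred) {y : Fin m → Bool} {J₀ : Finset (Fin m)} {e : Fin m}
    (_he : e ∈ J₀) (S : Finset (Fin n))
    (hodd : Odd ((univ.filter fun s : Fin 4 => s.val < 2 ∧ I.vars e s ∈ S).card))
    (heven : ∀ j ∈ J₀, j ≠ e → Even ((univ.filter fun s : Fin 4 => s.val < 2 ∧ I.vars j s ∈ S).card))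
    (hand : ∀ j : Fin m, I.vars j 2 ∉ S ∧ I.vars j 3 ∉ S)
    (A w₂ : Finset (Fin n) × Finset (Fin m) × Bool) (hA : Even ((A.1 ∩ S).card)) (hw : Even ((w₂.1 ∩ S).card))
    (h : SatPair I y (J₀.erase e) A w₂) : SatPair I y J₀ A w₂ := by
  obtain ⟨x, hx, hxA, hxw⟩ := h
  by_cases hxe : I.eval x e = y e
  · exact ⟨x, fun j hj => if hje : j = e then hje ▸ hxe else hx j (mem_erase.2 ⟨hje, hj⟩), hxA, hxw⟩
  · refine ⟨flipOn S x, fun j hj => ?_, by rw [gval_flipOn I S x A (fun g hg => hand g) hA]; exact hxA,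
      by rw [gval_flipOn I S x w₂ (fun g hg => hand g) hw]; exact hxw⟩
    by_cases hje : j = e
    · subst hje
      rw [eval_flipOn_of_odd I hI S x j (hand j) hodd]
      revert hxe; cases I.eval x j <;> cases y j <;> simp
    · rw [eval_flipOn_of_even I hI S x j (hand j) (heven j hj hje)]
      exact hx j (mem_erase.2 ⟨hje, hj⟩)

end Summit.PneNP.PneNP.Theorems.PstarUnionBridge
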